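import Literature.Barriers.CriticalPhenomena.TimarMassTransport
import Mathlib.Combinatorics.SimpleGraph.Acyclic
import Mathlib.Combinatorics.SimpleGraph.DegreeSum
import HarnessLib

/-!
# A cut-count mass transport for finite classes of a pointing forest — a replacement for the
# bag construction in the proof of Timár 2006, Thm. 5.5

Barrier catalogue `Literature/Barriers/CriticalPhenomena/`; a brick of the programme proving
Timár's Thm. 5.5 (`Timar2006_finiteLevelUnion`, `TimarCriticalNonunimodular.lean`; Á. Timár,
*Percolation on nonunimodular transitive graphs*, Ann. Probab. 34 (2006) 2344–2364, §5,
pp. 2358–2360). The printed proof ends by comparing two expected degrees: the forest `F` on the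
encounter points of a class `L₀` of the 1-partition (out-degree `≥ 3` at every point: "every
point `x` in `F` has degree `≥ 3` because each element of `W` is incident to at least one edge for
each infinite component that results from the component of `x` after the deletion of `x`") is
thinned through bags and leaders to a forest `Φ` of expected degree `> 2μ`, while its exhaustion
`R_i` along the finite unions of levels of Prop. 5.4 has only finite components and hence expected
degree `≤ 2μ` by Lemma 5.1; "the sequence `(R_i)_i` exhausts `Φ` … This contradicts the fact that
the expected degree in `Φ` is `> 2μ`."

This file PROVES a variant of that endgame which needs neither bags, leaders, the extra
percolation nor Lemma 5.1. Partition the points of `F` into the FINITE classes `Q` cut out by a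
finite union of levels (finite by the standing assumption of the proof, "all connected components
in `C ∩ L` are finite"). Deterministically (`card_add_two_le_sum_encard_cut`): `F` is acyclic and
every point of `Q` has at least `3` out-targets, while at most `2(|Q| - 1)` pointing pairs have
both ends in `Q` (`card_filter_adj_add_two_le`), so **at least `|Q| + 2` out-edges of points of
`Q` leave `Q`**. Spreading the number `cut(x)` of out-edges of `x` leaving its class equally over
the class (the cluster-averaging transport of the proof of Lemma 5.1, applied to cut counts instead
of degrees, `cutTransport`) and applying the nonunimodular MTP (Lemma 2.2 in its random form,
`lintegral_tsum_eq_inv_autWeight_mul`) with the weight bound `w(x) ≤ B w(y)` inside a class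
(`B = μ` for a class of the 1-partition) gives, on an abstract invariant space and for every
equivariant choice of the classes and the cut counts (`measure_le_mul_lintegral_cut`),

  `P(o ∈ D) ≤ B · E[cut(o); o ∈ D]`      (`D` = the points of the forest).

Along the exhaustion of Prop. 5.4 the left side is a positive constant while `E[cut_i(o)] → 0`
(every out-edge is realised by an open path meeting finitely many levels), which is the
contradiction proving Thm. 5.5 on this route. The abstract setting (a measure on `Ω` preserved by
measurable maps `act γ`, `γ ∈ Aut(G)`) is that of `TimarMassTransport.lean`.

## References

* Á. Timár, Ann. Probab. 34 (2006) 2344–2364 (arXiv:math/0702875), §5: proof of Thm. 5.5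
  (the forest `F`, degrees `≥ 3`, the exhaustion `R_i`, the final contradiction), Lemma 5.1
  (proof: the cluster-averaging transport), Lemma 2.2. [Timar2006]
* R. Lyons, Y. Peres, *Probability on Trees and Networks*, CUP 2016, Exercise 7.3 (a finite set
  `K` of vertices of a forest with all degrees `≥ 3` has at least `|K| + 2` edges leaving it),
  §8.2 ((8.10)). [LyonsPeres2016]
-/

noncomputable section

namespace Literature.Barriers.CriticalPhenomena

open _root_.MeasureTheory Literature.Probability.Percolation SimpleGraph Finset
open scoped ENNReal

variable {V : Type*}

/-! ### Finite vertex sets of a forest span few edges -/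

/-- **A finite nonempty set `Q` of vertices of an acyclic graph spans at most `|Q| - 1` edges**,
counted as ordered adjacent pairs: `#{(a, b) ∈ Q × Q : a ∼ b} + 2 ≤ 2|Q|` (the induced forest on
`Q` extends to a spanning tree of the complete graph on `Q`, which has `|Q| - 1` edges).
[cite: LyonsPeres2016, Exercise 7.3] -/
theorem card_filter_adj_add_two_le {M : SimpleGraph V} (hM : M.IsAcyclic) (Q : Finset V)
    (hQ : Q.Nonempty) [DecidableRel M.Adj] :
    #((Q ×ˢ Q).filter fun p => M.Adj p.1 p.2) + 2 ≤ 2 * #Q := by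
  classical
  -- the induced forest on the finite type `Q`
  set T' : SimpleGraph ↥Q := M.induce (↑Q : Set V) with hT'
  have hT'acyc : T'.IsAcyclic := hM.induce _
  haveI : Nonempty ↥Q := ⟨⟨hQ.choose, hQ.choose_spec⟩⟩
  -- a spanning tree of the complete graph on `Q` containing it
  obtain ⟨T, hT'T, -, hT⟩ :=
    (connected_top : (⊤ : SimpleGraph ↥Q).Connected).exists_isTree_le_of_le_of_isAcyclic
      le_top hT'acyc
  have hE : #T.edgeFinset + 1 = Fintype.card ↥Q := hT.card_edgeFinset
  have hsub : #T'.edgeFinset ≤ #T.edgeFinset := card_le_card (edgeFinset_mono hT'T)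
  have hdarts : 2 * #T'.edgeFinset = #(univ.filter fun p : ↥Q × ↥Q => T'.Adj p.1 p.2) :=
    T'.two_mul_card_edgeFinset
  have hcardQ : Fintype.card ↥Q = #Q := Fintype.card_coe Q
  -- the ordered adjacent pairs of `Q` are those of `T'`
  have hpairs : #((Q ×ˢ Q).filter fun p => M.Adj p.1 p.2) =
      #(univ.filter fun p : ↥Q × ↥Q => T'.Adj p.1 p.2) := by
    symm
    refine card_bij (fun p _ => ((p.1 : V), (p.2 : V))) ?_ ?_ ?_
    · rintro ⟨a, b⟩ h
      simp only [mem_filter, mem_univ, true_and] at h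
      simp only [mem_filter, mem_product]
      exact ⟨⟨a.2, b.2⟩, h⟩
    · rintro ⟨a, b⟩ _ ⟨a', b'⟩ _ h
      simp only [Prod.mk.injEq] at h
      exact Prod.ext (Subtype.ext h.1) (Subtype.ext h.2)
    · rintro ⟨a, b⟩ h
      simp only [mem_filter, mem_product] at h
      refine ⟨(⟨a, h.1.1⟩, ⟨b, h.1.2⟩), ?_, rfl⟩
      simp only [mem_filter, mem_univ, true_and]
      simpa [hT'] using h.2
  omega

/-! ### The deficit of a finite class of a pointing forest -/

/-- **At least `|Q| + 2` out-edges leave a finite nonempty class `Q` of a pointing forest**: if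
every pointing pair is an edge of an acyclic graph `M` ("Denote by `M` the graph that results from
ignoring the directions of the edges", Timár 2006, proof of Thm. 5.5) and every point of `Q` points
to at least `3` targets ("every point `x` in `F` has degree `≥ 3`"), then, since at most
`2(|Q| - 1)` pointing pairs have both ends in `Q` (`card_filter_adj_add_two_le`),
`|Q| + 2 ≤ Σ_{x ∈ Q} #{t : x → t, t ∉ Q}`.
[cite: Timar2006, Thm. 5.5 (proof: the forest F, degrees ≥ 3)] [cite: LyonsPeres2016, Exercise 7.3] -/
theorem card_add_two_le_sum_encard_cut {M : SimpleGraph V} (hM : M.IsAcyclic) {Pt : V → V → Prop}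
    (hPt : ∀ a b, Pt a b → M.Adj a b) (Q : Finset V) (hQ : Q.Nonempty)
    (h3 : ∀ x ∈ Q, 3 ≤ ({t | Pt x t} : Set V).encard) :
    (#Q : ℕ∞) + 2 ≤ ∑ x ∈ Q, ({t | Pt x t ∧ t ∉ Q} : Set V).encard := by
  classical
  -- inside targets and outside targets of `x ∈ Q`
  have hsplit : ∀ x ∈ Q, ({t | Pt x t} : Set V).encard =
      (#(Q.filter fun t => Pt x t) : ℕ∞) + ({t | Pt x t ∧ t ∉ Q} : Set V).encard := by
    intro x _
    rw [← Set.encard_coe_eq_coe_finsetCard, ← Set.encard_union_eq]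
    · congr 1
      ext t
      simp only [Set.mem_setOf_eq, Set.mem_union, coe_filter]
      by_cases ht : t ∈ Q <;> simp [ht]
    · rw [Set.disjoint_left]
      rintro t ht ⟨-, htQ⟩
      rw [coe_filter] at ht
      exact htQ ht.1
  -- the inside pairs are ordered adjacent pairs of `M` in `Q × Q`
  set A := (Q ×ˢ Q).filter fun p => M.Adj p.1 p.2 with hA
  have hin : ∑ x ∈ Q, #(Q.filter fun t => Pt x t) ≤ #A := by
    have h1 : ∑ x ∈ Q, #(Q.filter fun t => Pt x t) = #((Q ×ˢ Q).filter fun p => Pt p.1 p.2) := by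
      rw [card_filter, sum_product]
      refine sum_congr rfl fun x _ => ?_
      rw [card_filter]
    rw [h1]
    refine card_le_card fun p hp => ?_
    rw [mem_filter] at hp ⊢
    exact ⟨hp.1, hPt _ _ hp.2⟩
  have hA2 : #A + 2 ≤ 2 * #Q := card_filter_adj_add_two_le hM Q hQ
  -- `3|Q| ≤ Σ_x #targets = (inside) + (outside) ≤ 2|Q| - 2 + outside`
  have h3sum : ((3 * #Q : ℕ) : ℕ∞) ≤ ∑ x ∈ Q, ({t | Pt x t} : Set V).encard := by
    calc ((3 * #Q : ℕ) : ℕ∞) = ∑ _x ∈ Q, (3 : ℕ∞) := by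
          rw [sum_const, nsmul_eq_mul]; push_cast; ring
      _ ≤ ∑ x ∈ Q, ({t | Pt x t} : Set V).encard := sum_le_sum h3
  rw [sum_congr rfl hsplit, sum_add_distrib] at h3sum
  set S := ∑ x ∈ Q, ({t | Pt x t ∧ t ∉ Q} : Set V).encard with hS
  set a : ℕ := ∑ x ∈ Q, #(Q.filter fun t => Pt x t) with ha
  have h3sum' : ((3 * #Q : ℕ) : ℕ∞) ≤ (a : ℕ∞) + S := by
    rw [ha]; push_cast; exact h3sum
  -- cancel the finite quantity `a`
  have hkey : ((#Q + 2 : ℕ) : ℕ∞) + (a : ℕ∞) ≤ S + (a : ℕ∞) := by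
    calc ((#Q + 2 : ℕ) : ℕ∞) + (a : ℕ∞) = ((#Q + 2 + a : ℕ) : ℕ∞) := by push_cast; ring
      _ ≤ ((3 * #Q : ℕ) : ℕ∞) := by exact_mod_cast (by omega : #Q + 2 + a ≤ 3 * #Q)
      _ ≤ (a : ℕ∞) + S := h3sum'
      _ = S + (a : ℕ∞) := add_comm _ _
  have := (WithTop.add_le_add_iff_right (WithTop.coe_ne_top (a := a))).1 hkey
  exact_mod_cast this

/-! ### The class-averaging cut transport -/

/-- **The class-averaging cut transport**: a point `x ∈ D` spreads its cut count `cut(x)` equally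
over its class, `T(x, y) = cut(x) / |cls(x)|` for `y ∈ cls(x)` (the transport of the proof of
Lemma 5.1, "redistribute it equally among the vertices in its (finite) cluster", with degrees
replaced by cut counts). [cite: Timar2006, Lemma 5.1 (proof: the mass transport)] -/
def cutTransport (D : Set V) (cls : V → Set V) (cut : V → ℝ≥0∞) (x y : V) : ℝ≥0∞ :=
  (D ∩ {x' | y ∈ cls x'}).indicator (fun x' => cut x' / ((cls x').encard : ℝ≥0∞)) x

/-- `|cls x| ≠ 0` in `[0, ∞]` for a class containing `x`. [folklore] -/
theorem encard_toENNReal_ne_zero {s : Set V} {x : V} (hx : x ∈ s) : (s.encard : ℝ≥0∞) ≠ 0 := by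
  rw [Ne, ENat.toENNReal_eq_zero, Set.encard_eq_zero]
  exact fun h => (h ▸ hx : x ∈ (∅ : Set V))

/-- `|cls x| ≠ ∞` in `[0, ∞]` for a finite class. [folklore] -/
theorem encard_toENNReal_ne_top {s : Set V} (hs : s.Finite) : (s.encard : ℝ≥0∞) ≠ ⊤ := by
  rw [Ne, ENat.toENNReal_eq_top, Set.encard_eq_top_iff]
  exact fun h => h hs

/-- **Mass sent**: `Σ_y T(x, y) = cut(x)` for `x ∈ D` with a finite class containing `x`.
[cite: Timar2006, Lemma 5.1 (proof: mass sent out)] -/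
theorem tsum_cutTransport_of_mem {D : Set V} {cls : V → Set V} (cut : V → ℝ≥0∞) {x : V}
    (hx : x ∈ D) (hxx : x ∈ cls x) (hfin : (cls x).Finite) :
    ∑' y, cutTransport D cls cut x y = cut x := by
  classical
  have h : ∀ y, cutTransport D cls cut x y =
      (cls x).indicator (fun _ => cut x / ((cls x).encard : ℝ≥0∞)) y := by
    intro y
    by_cases hy : y ∈ cls x
    · rw [cutTransport, Set.indicator_of_mem (show x ∈ D ∩ {x' | y ∈ cls x'} from ⟨hx, hy⟩),
        Set.indicator_of_mem hy]
    · rw [cutTransport, Set.indicator_of_notMem (fun h => hy h.2), Set.indicator_of_notMem hy]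
  rw [tsum_congr h, tsum_indicator_const, mul_comm,
    ENNReal.div_mul_cancel (encard_toENNReal_ne_zero hxx) (encard_toENNReal_ne_top hfin)]

/-- Outside `D` no mass is sent. [folklore] -/
theorem tsum_cutTransport_of_notMem {D : Set V} {cls : V → Set V} (cut : V → ℝ≥0∞) {x : V}
    (hx : x ∉ D) : ∑' y, cutTransport D cls cut x y = 0 := by
  refine ENNReal.tsum_eq_zero.2 fun y => ?_
  rw [cutTransport, Set.indicator_of_notMem (fun h => hx h.1)]

/-- **Mass received comes from the class**: if the classes through the points of `D` partition
`D`, then `T(y, x) = cut(y) / |cls x|` for `y ∈ cls x` and `0` otherwise (`x ∈ D`). [folklore] -/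
theorem cutTransport_eq_of_partition {D : Set V} {cls : V → Set V} (cut : V → ℝ≥0∞) {x : V}
    (hx : x ∈ D) (hself : ∀ y ∈ D, y ∈ cls y) (hsub : cls x ⊆ D)
    (hpart : ∀ y ∈ D, ∀ z ∈ cls y, cls z = cls y) (y : V) :
    cutTransport D cls cut y x =
      (cls x).indicator (fun y => cut y / ((cls x).encard : ℝ≥0∞)) y := by
  classical
  by_cases hy : y ∈ cls x
  · have hyD : y ∈ D := hsub hy
    have hcls : cls y = cls x := hpart x hx y hy
    have hxy : x ∈ cls y := hcls ▸ hself x hx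
    rw [cutTransport, Set.indicator_of_mem (show y ∈ D ∩ {x' | x ∈ cls x'} from ⟨hyD, hxy⟩),
      Set.indicator_of_mem hy, hcls]
  · rw [Set.indicator_of_notMem hy, cutTransport, Set.indicator_of_notMem]
    rintro ⟨hyD, hxy⟩
    have hcls : cls x = cls y := hpart y hyD x hxy
    exact hy (hcls ▸ hself y hyD)

/-- **Weighted mass received**: if the classes through the points of `D` partition `D`
(`y ∈ cls y ⊆ D`, `cls z = cls y` for `z ∈ cls y`), the class of `x ∈ D` is finite, the weights on
it satisfy `w(x) ≤ B w(y)`, and the deficit `|cls x| ≤ Σ_{y ∈ cls x} cut(y)` holds, then the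
`w`-weighted mass received by `x`, `Σ_y T(y, x) w(y) = Σ_{y ∈ cls x} cut(y) w(y) / |cls x|`,
satisfies `w(x) ≤ B · Σ_y T(y, x) w(y)`. [cite: Timar2006, Lemma 5.1 (proof: mass received)] -/
theorem autWeight_le_mul_tsum_cutTransport {G : SimpleGraph V} {D : Set V} {cls : V → Set V}
    (cut : V → ℝ≥0∞) (o : V) {B : ℝ≥0∞} {x : V} (hx : x ∈ D) (hself : ∀ y ∈ D, y ∈ cls y)
    (hsub : cls x ⊆ D) (hpart : ∀ y ∈ D, ∀ z ∈ cls y, cls z = cls y) (hfin : (cls x).Finite)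
    (htilt : ∀ y ∈ cls x, autWeight G o x ≤ B * autWeight G o y)
    (hdef : ((cls x).encard : ℝ≥0∞) ≤ ∑' y, (cls x).indicator cut y) :
    autWeight G o x ≤ B * ∑' y, cutTransport D cls cut y x * autWeight G o y := by
  classical
  set E : ℝ≥0∞ := ((cls x).encard : ℝ≥0∞) with hE
  have hE0 : E ≠ 0 := encard_toENNReal_ne_zero (hself x hx)
  have hET : E ≠ ⊤ := encard_toENNReal_ne_top hfin
  have hT := cutTransport_eq_of_partition cut hx hself hsub hpart
  -- `B · T(y, x) w(y) ≥ T(y, x) w(x)` termwise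
  have hterm : ∀ y, cutTransport D cls cut y x * autWeight G o x ≤
      B * (cutTransport D cls cut y x * autWeight G o y) := by
    intro y
    by_cases hy : y ∈ cls x
    · calc cutTransport D cls cut y x * autWeight G o x
          ≤ cutTransport D cls cut y x * (B * autWeight G o y) := mul_le_mul' le_rfl (htilt y hy)
        _ = B * (cutTransport D cls cut y x * autWeight G o y) := by ring
    · rw [hT y, Set.indicator_of_notMem hy, zero_mul, zero_mul, mul_zero]
  -- `Σ_y T(y, x) = (Σ_{y ∈ cls x} cut y) / E ≥ 1`
  have hsumT : 1 ≤ ∑' y, cutTransport D cls cut y x := by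
    have h1 : ∑' y, cutTransport D cls cut y x = (∑' y, (cls x).indicator cut y) / E := by
      rw [tsum_congr hT, div_eq_mul_inv, ← ENNReal.tsum_mul_right]
      refine tsum_congr fun y => ?_
      by_cases hy : y ∈ cls x
      · rw [Set.indicator_of_mem hy, Set.indicator_of_mem hy, div_eq_mul_inv]
      · rw [Set.indicator_of_notMem hy, Set.indicator_of_notMem hy, zero_mul]
    rw [h1, ENNReal.le_div_iff_mul_le (Or.inl hE0) (Or.inl hET), one_mul]
    exact hdef
  calc autWeight G o x = 1 * autWeight G o x := (one_mul _).symm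
    _ ≤ (∑' y, cutTransport D cls cut y x) * autWeight G o x := mul_le_mul' hsumT le_rfl
    _ = ∑' y, cutTransport D cls cut y x * autWeight G o x := ENNReal.tsum_mul_right.symm
    _ ≤ ∑' y, B * (cutTransport D cls cut y x * autWeight G o y) := ENNReal.tsum_le_tsum hterm
    _ = B * ∑' y, cutTransport D cls cut y x * autWeight G o y := ENNReal.tsum_mul_left

/-! ### The cut transport on an invariant space -/

section Invariant

variable {Ω : Type*} [MeasurableSpace Ω] {G : SimpleGraph V} [G.LocallyFinite]

omit [MeasurableSpace Ω] [G.LocallyFinite] in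
/-- `cutTransport` is diagonally invariant when `D`, the classes and the cut counts are
equivariant. [folklore] -/
theorem cutTransport_equivariant {act : (G ≃g G) → Ω → Ω} {D : Ω → Set V} {cls : Ω → V → Set V}
    {cut : Ω → V → ℝ≥0∞} (hDinv : ∀ γ ξ x, γ x ∈ D (act γ ξ) ↔ x ∈ D ξ)
    (hclsinv : ∀ γ ξ x y, γ y ∈ cls (act γ ξ) (γ x) ↔ y ∈ cls ξ x)
    (hcutinv : ∀ γ ξ x, cut (act γ ξ) (γ x) = cut ξ x) (γ : G ≃g G) (x y : V) (ξ : Ω) :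
    cutTransport (D (act γ ξ)) (cls (act γ ξ)) (cut (act γ ξ)) (γ x) (γ y) =
      cutTransport (D ξ) (cls ξ) (cut ξ) x y := by
  classical
  have himg : cls (act γ ξ) (γ x) = (γ : V → V) '' cls ξ x := by
    ext z
    constructor
    · intro hz
      refine ⟨γ.symm z, ?_, γ.apply_symm_apply z⟩
      rw [← hclsinv γ ξ x, γ.apply_symm_apply]
      exact hz
    · rintro ⟨y', hy', rfl⟩
      exact (hclsinv γ ξ x y').2 hy'
  have hmem : (γ x ∈ D (act γ ξ) ∩ {x' | γ y ∈ cls (act γ ξ) x'}) ↔ (x ∈ D ξ ∩ {x' | y ∈ cls ξ x'}) := by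
    simp only [Set.mem_inter_iff, Set.mem_setOf_eq, hDinv, hclsinv]
  unfold cutTransport
  by_cases h : x ∈ D ξ ∩ {x' | y ∈ cls ξ x'}
  · rw [Set.indicator_of_mem (hmem.2 h), Set.indicator_of_mem h, hcutinv, himg,
      γ.injective.encard_image]
  · rw [Set.indicator_of_notMem (fun h' => h (hmem.1 h')), Set.indicator_of_notMem h]

variable [Countable V]

omit [G.LocallyFinite] in
/-- The class size `ξ ↦ |cls ξ x|` is measurable when membership is. [folklore] -/
theorem measurable_encard_cls {cls : Ω → V → Set V} (hclsm : ∀ x y, MeasurableSet {ξ | y ∈ cls ξ x})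
    (x : V) : Measurable fun ξ => ((cls ξ x).encard : ℝ≥0∞) := by
  have h : ∀ ξ, ((cls ξ x).encard : ℝ≥0∞) = ∑' y, (cls ξ x).indicator 1 y := by
    intro ξ
    rw [show (1 : V → ℝ≥0∞) = fun _ => 1 from rfl, tsum_indicator_const, mul_one]
  simp_rw [h]
  refine measurable_tsum_ennreal fun y => measurable_one.indicator ?_
  exact hclsm x y

omit [G.LocallyFinite] in
/-- **`cutTransport` depends measurably on `ξ`.** [folklore] -/
theorem measurable_cutTransport {D : Ω → Set V} {cls : Ω → V → Set V} {cut : Ω → V → ℝ≥0∞}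
    (hDm : ∀ x, MeasurableSet {ξ | x ∈ D ξ}) (hclsm : ∀ x y, MeasurableSet {ξ | y ∈ cls ξ x})
    (hcutm : ∀ x, Measurable fun ξ => cut ξ x) (x y : V) :
    Measurable fun ξ => cutTransport (D ξ) (cls ξ) (cut ξ) x y := by
  classical
  have h : ∀ ξ, cutTransport (D ξ) (cls ξ) (cut ξ) x y =
      ({ξ | x ∈ D ξ} ∩ {ξ | y ∈ cls ξ x}).indicator
        (fun ξ => cut ξ x / ((cls ξ x).encard : ℝ≥0∞)) ξ := by
    intro ξ
    simp only [cutTransport, Set.indicator_apply, Set.mem_inter_iff, Set.mem_setOf_eq]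
  simp_rw [h]
  refine Measurable.indicator ((hcutm x).div (measurable_encard_cls hclsm x)) ?_
  exact (hDm x).inter (hclsm x y)

/-- **The cut-count MTP, PROVED (abstract form).** Let `P` be a measure on `Ω` preserved by
measurable maps `act γ`, `γ ∈ Aut(G)`, of a connected, locally finite, transitive graph `G`
(weights `w = autWeight G o`). Let `D : Ω → Set V` (the points of the forest), `cls : Ω → V → Set V`
(the classes cut out of `D` by a finite union of levels) and `cut : Ω → V → [0, ∞]` (the number of
out-edges of a point leaving its class) be measurable and equivariant, such that almost surely, for
every `x ∈ D`: `x ∈ cls x ⊆ D`, `cls y = cls x` for `y ∈ cls x` (the classes partition `D`),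
`cls x` is finite ("all connected components in `C ∩ L` are finite"), `w(x) ≤ B w(y)` on `cls x`
(a class lies inside one class of the 1-partition, `B = μ`), and the deficit
`|cls x| ≤ Σ_{y ∈ cls x} cut(y)` holds (`card_add_two_le_sum_encard_cut`). Then

  `P(x ∈ D) ≤ B · E[cut(x); x ∈ D]`  for every vertex `x`.

Proof: Lemma 2.2 (`lintegral_tsum_eq_inv_autWeight_mul`) for the class-averaging cut transport:
`E[cut(x); x ∈ D] = E[Σ_y T(x, y)] = w(x)⁻¹ E[Σ_y T(y, x) w(y)] ≥ w(x)⁻¹ B⁻¹ w(x) P(x ∈ D)`.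
[cite: Timar2006, Thm. 5.5 (proof: final contradiction) and Lemma 5.1 (proof), Lemma 2.2] -/
theorem measure_le_mul_lintegral_cut (hconn : G.Connected) (ht : IsGraphTransitive G)
    (μ : Measure Ω) (act : (G ≃g G) → Ω → Ω) (hact : ∀ γ, Measurable (act γ))
    (hμ : ∀ γ, μ.map (act γ) = μ) {D : Ω → Set V} {cls : Ω → V → Set V} {cut : Ω → V → ℝ≥0∞}
    (hDm : ∀ x, MeasurableSet {ξ | x ∈ D ξ}) (hclsm : ∀ x y, MeasurableSet {ξ | y ∈ cls ξ x})
    (hcutm : ∀ x, Measurable fun ξ => cut ξ x)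
    (hDinv : ∀ γ ξ x, γ x ∈ D (act γ ξ) ↔ x ∈ D ξ)
    (hclsinv : ∀ γ ξ x y, γ y ∈ cls (act γ ξ) (γ x) ↔ y ∈ cls ξ x)
    (hcutinv : ∀ γ ξ x, cut (act γ ξ) (γ x) = cut ξ x) (o : V) {B : ℝ≥0∞}
    (hgood : ∀ᵐ ξ ∂μ, ∀ x ∈ D ξ, x ∈ cls ξ x ∧ cls ξ x ⊆ D ξ ∧ (∀ y ∈ cls ξ x, cls ξ y = cls ξ x) ∧
      (cls ξ x).Finite ∧ (∀ y ∈ cls ξ x, autWeight G o x ≤ B * autWeight G o y) ∧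
      ((cls ξ x).encard : ℝ≥0∞) ≤ ∑' y, (cls ξ x).indicator (cut ξ) y) (x : V) :
    μ {ξ | x ∈ D ξ} ≤ B * ∫⁻ ξ, {ξ | x ∈ D ξ}.indicator (fun ξ => cut ξ x) ξ ∂μ := by
  classical
  have hmtp := lintegral_tsum_eq_inv_autWeight_mul G hconn ht μ act hact hμ
    (φ := fun x y ξ => cutTransport (D ξ) (cls ξ) (cut ξ) x y)
    (fun x y => measurable_cutTransport hDm hclsm hcutm x y)
    (fun γ x y ξ => cutTransport_equivariant hDinv hclsinv hcutinv γ x y ξ) o x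
  have hx0 := autWeight_ne_zero G hconn o x
  have hxT := autWeight_ne_top G hconn o x
  -- left side: a.s. `Σ_y T(x, y) = cut(x) 1[x ∈ D]`
  have hleft : ∫⁻ ξ, {ξ | x ∈ D ξ}.indicator (fun ξ => cut ξ x) ξ ∂μ =
      ∫⁻ ξ, ∑' y, cutTransport (D ξ) (cls ξ) (cut ξ) x y ∂μ := by
    refine lintegral_congr_ae ?_
    filter_upwards [hgood] with ξ hξ
    by_cases hxD : x ∈ D ξ
    · obtain ⟨hxx, -, -, hfin, -, -⟩ := hξ x hxD
      rw [Set.indicator_of_mem (show ξ ∈ {ξ | x ∈ D ξ} from hxD),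
        tsum_cutTransport_of_mem (cut ξ) hxD hxx hfin]
    · rw [Set.indicator_of_notMem (show ξ ∉ {ξ | x ∈ D ξ} from hxD),
        tsum_cutTransport_of_notMem (cut ξ) hxD]
  -- right side: a.s. `w(x) 1[x ∈ D] ≤ B Σ_y T(y, x) w(y)`
  have hright : ∫⁻ ξ, {ξ | x ∈ D ξ}.indicator (fun _ => autWeight G o x) ξ ∂μ ≤
      ∫⁻ ξ, B * ∑' y, cutTransport (D ξ) (cls ξ) (cut ξ) y x * autWeight G o y ∂μ := by
    refine lintegral_mono_ae ?_
    filter_upwards [hgood] with ξ hξ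
    by_cases hxD : x ∈ D ξ
    · obtain ⟨-, hsub, -, hfin, htilt, hdef⟩ := hξ x hxD
      rw [Set.indicator_of_mem (show ξ ∈ {ξ | x ∈ D ξ} from hxD)]
      exact autWeight_le_mul_tsum_cutTransport (cut ξ) o hxD (fun y hy => (hξ y hy).1) hsub
        (fun y hy z hz => ((hξ y hy).2.2.1) z hz) hfin htilt hdef
    · rw [Set.indicator_of_notMem (show ξ ∉ {ξ | x ∈ D ξ} from hxD)]
      exact zero_le
  have hmeas : Measurable fun ξ => ∑' y, cutTransport (D ξ) (cls ξ) (cut ξ) y x * autWeight G o y :=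
    measurable_tsum_ennreal fun y => (measurable_cutTransport hDm hclsm hcutm y x).mul_const _
  -- assemble
  calc μ {ξ | x ∈ D ξ}
      = (autWeight G o x)⁻¹ * (autWeight G o x * μ {ξ | x ∈ D ξ}) := by
        rw [← mul_assoc, ENNReal.inv_mul_cancel hx0 hxT, one_mul]
    _ = (autWeight G o x)⁻¹ * ∫⁻ ξ, {ξ | x ∈ D ξ}.indicator (fun _ => autWeight G o x) ξ ∂μ := by
        rw [lintegral_indicator_const (hDm x)]
    _ ≤ (autWeight G o x)⁻¹ * ∫⁻ ξ, B * ∑' y, cutTransport (D ξ) (cls ξ) (cut ξ) y x * autWeight G o y ∂μ :=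
        mul_le_mul' le_rfl hright
    _ = B * ((autWeight G o x)⁻¹ *
          ∫⁻ ξ, ∑' y, cutTransport (D ξ) (cls ξ) (cut ξ) y x * autWeight G o y ∂μ) := by
        rw [lintegral_const_mul _ hmeas]; ring
    _ = B * ∫⁻ ξ, {ξ | x ∈ D ξ}.indicator (fun ξ => cut ξ x) ξ ∂μ := by rw [hleft, hmtp]

end Invariant

end Literature.Barriers.CriticalPhenomena

end
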